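import Summits.Parity.GeneralizedHardyLittlewood.Theorems.PrimeLevelFamEdgeMomentsBeyondDiagonalDiagDecorMasterInputs
import Summits.Parity.GeneralizedHardyLittlewood.Theorems.PrimeLevelFamEdgeMomentsBeyondDiagonalDiagDecorLogGMonomial
import HarnessLib

/-!
# Route `PrimeLevelFamEdge`, crux K_A `MomentsBeyondDiagonal` (stmt-Parity-20007), line «petersson_layers» v4, stub `stub_diag`:
# **the SHIFTED profile coordinates `𝒮^{[r]}` and the bilinear main term of `(λ log M − log(M/n))^p·𝒮^{[r₁]}𝒮^{[r₂]}`**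
# (the `β + ℓ⁺` scheme for the `L`-powers of the per-order weights — no `(log k)^σ` decorations at all)

Census R3(ii), ANALYTIC HALF. After the Hecke-divisor summation (`…DiagDecorWeightOneOne`, p824224) the polynomial part
of the order-`(1,1)` target is `Sel(τ(k₁)τ(k₂)·L^m)` (+ the `P₂` family), `L = log(Q²/(n₁n₂))`. Instead of expanding
`L = 2 log Q − 2 log g − log k₁ − log k₂` into `(log k)^σ`-decorated engines (g9 item (a)), write with `n = cg`, `Y = M/n`:
`L = Λ₁ + Λ₂`, `Λ_i = log(Q/(gk_i)) = B + ℓ⁺(k_i)`, `ℓ⁺(k) = log(Y/k)`, `B = log Q − log g − log(M/n)`.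
The decoration `ℓ⁺(k)^r τ(k)` costs NOTHING: `Σ_{k≤Y} a_n(k)ℓ⁺(k)^r logᶜ(Y/k) = S⁽ᶜ⁺ʳ⁾(Y;n)` is the UNDECORATED engine at the
shifted order `c + r`, i.e. the profile coordinate of the shifted profile `X^r·P` — so `…DiagDecorMasterInputs.masterInput_tau`
applies verbatim. This file:

* `coeff_X_pow_mul_zero`, `coeff_X_pow_mul_one`, `sum_coeff_X_pow_mul` — bookkeeping of the shifted profile `X^r·P`;
* `shiftedCoord_eq` — **`𝒮^{[r]}(M,n) := Σ_c P_c S⁽ᶜ⁺ʳ⁾(M/n;n)/logᶜM = log^rM · (profile coordinate of X^rP)`**;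
* `abs_shiftedCoord_sub_le` — **two-scale master format: `|𝒮^{[r]}/log^rM − E_n (X^rP)″(u_n)/log²M| ≤ C·D(n)((1+κ)/log³M +
  1/((1+log(M/n))²log²M))`**; `abs_shiftedCoord_le` — crude size `|𝒮^{[r]}| ≤ K·D(n)·log^rM/log²M`;
* `abs_harmonicShifted_sub_le` — **for `0 ≤ λ ≤ 1` and all `p, r₁, r₂`:
  `|Σ_{n≤M} φ(n)W(n)²(λ log M − log(M/n))^p 𝒮^{[r₁]}(n)𝒮^{[r₂]}(n) − (π²/6)²·(∫₀¹(λ−u)^p(u^{r₁}P)″(u^{r₂}P)″du)·log^{p+r₁+r₂}M·log M/log⁴M|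
  ≤ C·log^{p+r₁+r₂}M/log⁴M`** (`…DiagDecorBilinearTwoScale` with `S₁ = (λ−u_n)^p𝒮^{[r₁]}/log^{r₁}M`).

With `Σ_r C(i,r)(λ−u)^{i−r}(u^rP)″ = λ^iP″ + 2iλ^{i−1}P′ + i(i−1)λ^{i−2}P =: R_i(u)` this gives (after the `(log g)^t`
collapse bounds, next file) `Sel(ττL^m) = (π²/6)²·log^{m−3}M·Σ_i C(m,i)∫₀¹R_iR_{m−i} + O(log^{m−4}M)` at `λ = log Q/log M = 1/Δ′`
(hand check: `m = 1` is the order-`(0,0)` value `2(P′(1)² + λ∫P″²)`; `m = 3` with the `P₂` family gives `τ₁₁ = B₁₁/2`).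
Def-free; theorems only. Helper `--supports stmt-Parity-20007`; closes nothing; K_A, K_B and the Parity summit are NOT
proved; nothing about Landau–Siegel zeros.

## References
* E. Kowalski, P. Michel, J. VanderKam, J. reine angew. Math. 526 (2000), (23)–(28) pp. 13–15 and Prop. 5.1 p. 18.
  [cite: KowalskiMichelVanderKam2000, (23)–(28) — derivation (diagonal main term in real Selberg coordinates)]
-/

noncomputable section

open scoped Real ArithmeticFunction.Moebius
open Finset ArithmeticFunction Polynomial MeasureTheory intervalIntegral

namespace Summit.Parity.GeneralizedHardyLittlewood.Theorems.MomentsBeyondDiagonal.DiagKernel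

open Literature.NumberTheory.LFunctions Literature.NumberTheory.LFunctions.KMV2000
open MollifierMainTerm (W)
open SelbergCoord (kappa)
open Literature.NumberTheory.Sieve (one_le_log_of_three_le)
open Summit.Parity.GeneralizedHardyLittlewood.Theorems.BeyondDiagonalBeatsQuarter.KernelFormXSq
  (mainConst divWeight divWeight_nonneg mainConst_nonneg)

/-! ### The shifted profile `X^r·P` -/

/-- `(X^r·P)₀ = 0` if `P₀ = 0`. [folklore] -/
theorem coeff_X_pow_mul_zero (P : ℝ[X]) (hP0 : P.coeff 0 = 0) (r : ℕ) : (X ^ r * P).coeff 0 = 0 := by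
  rw [Polynomial.coeff_X_pow_mul']
  split_ifs with h
  · rw [Nat.le_zero.1 h, Nat.sub_zero, hP0]
  · rfl

/-- `(X^r·P)₁ = 0` if `P₀ = P₁ = 0`. [folklore] -/
theorem coeff_X_pow_mul_one (P : ℝ[X]) (hP0 : P.coeff 0 = 0) (hP1 : P.coeff 1 = 0) (r : ℕ) :
    (X ^ r * P).coeff 1 = 0 := by
  rw [Polynomial.coeff_X_pow_mul']
  split_ifs with h
  · interval_cases r
    · rw [Nat.sub_zero, hP1]
    · rw [Nat.sub_self, hP0]
  · rfl

/-- Reindexing the coefficient sum of `X^r·P`: `Σ_{c≤deg(X^rP)} (X^rP)_c·f(c) = Σ_{c≤deg P} P_c·f(c+r)`. [folklore] -/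
theorem sum_coeff_X_pow_mul (P : ℝ[X]) (r : ℕ) (f : ℕ → ℝ) :
    ∑ c ∈ Finset.range ((X ^ r * P).natDegree + 1), (X ^ r * P).coeff c * f c =
      ∑ c ∈ Finset.range (P.natDegree + 1), P.coeff c * f (c + r) := by
  by_cases hP : P = 0
  · subst hP; simp
  rw [Polynomial.natDegree_X_pow_mul r hP, show P.natDegree + r + 1 = r + (P.natDegree + 1) by ring,
    Finset.sum_range_add]
  have h1 : ∑ c ∈ Finset.range r, (X ^ r * P).coeff c * f c = 0 := by
    refine Finset.sum_eq_zero fun c hc ↦ ?_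
    rw [Polynomial.coeff_X_pow_mul', if_neg (by have := Finset.mem_range.1 hc; omega), zero_mul]
  rw [h1, zero_add]
  refine Finset.sum_congr rfl fun c _ ↦ ?_
  rw [show r + c = c + r by ring, Polynomial.coeff_X_pow_mul]

/-! ### The shifted coordinate `𝒮^{[r]}` -/

/-- **`𝒮^{[r]}(M,n) = log^rM · (profile coordinate of X^r·P)`** (`M` with `log M ≠ 0`):
`Σ_c P_c·(Σ_k W[(k,n)=1]τ(k)log^{c+r}((M/n)/k))/logᶜM = log^rM·Σ_{c'}(X^rP)_{c'}(Σ_k W[(k,n)=1]τ(k)log^{c'}((M/n)/k))/log^{c'}M`.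
[cite: KowalskiMichelVanderKam2000, (23) — derivation] -/
theorem shiftedCoord_eq (P : ℝ[X]) (r : ℕ) {M : ℝ} (hM : Real.log M ≠ 0) (n : ℕ) :
    ∑ c ∈ Finset.range (P.natDegree + 1), P.coeff c *
        ((∑ k ∈ Icc 1 ⌊M / n⌋₊, (if k.Coprime n then W k else 0) * (k.divisors.card : ℝ) *
          Real.log (M / n / k) ^ (c + r)) / Real.log M ^ c) =
      Real.log M ^ r * ∑ c ∈ Finset.range ((X ^ r * P).natDegree + 1), (X ^ r * P).coeff c *
        ((∑ k ∈ Icc 1 ⌊M / n⌋₊, (if k.Coprime n then W k else 0) * (k.divisors.card : ℝ) *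
          Real.log (M / n / k) ^ c) / Real.log M ^ c) := by
  rw [sum_coeff_X_pow_mul, Finset.mul_sum]
  refine Finset.sum_congr rfl fun c _ ↦ ?_
  rw [pow_add]
  field_simp

/-- **The shifted coordinate in two-scale master format**: `|𝒮^{[r]}(M,n)/log^rM − E_n·(X^rP)″(u_n)/log²M| ≤
C·D(n)((1+κ(n))/log³M + 1/((1+log(M/n))²log²M))` (`P₀ = P₁ = 0`, `M ≥ 3`, `1 ≤ n ≤ M`).
[cite: KowalskiMichelVanderKam2000, Prop. 5.1 — derivation] -/
theorem abs_shiftedCoord_sub_le (P : ℝ[X]) (hP0 : P.coeff 0 = 0) (hP1 : P.coeff 1 = 0) (r : ℕ) :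
    ∃ C : ℝ, 0 ≤ C ∧ ∀ M : ℝ, 3 ≤ M → ∀ n : ℕ, n ≠ 0 → (n : ℝ) ≤ M →
      |(∑ c ∈ Finset.range (P.natDegree + 1), P.coeff c *
          ((∑ k ∈ Icc 1 ⌊M / n⌋₊, (if k.Coprime n then W k else 0) * (k.divisors.card : ℝ) *
            Real.log (M / n / k) ^ (c + r)) / Real.log M ^ c)) / Real.log M ^ r -
        mainConst n * (derivative (derivative (X ^ r * P))).eval (Real.log (M / n) / Real.log M) / Real.log M ^ 2| ≤
        C * divWeight n * ((1 + kappa n) / Real.log M ^ (2 + 1) +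
          1 / ((1 + Real.log (M / n)) ^ 2 * Real.log M ^ 2)) := by
  obtain ⟨C, hC, h⟩ := masterInput_tau (X ^ r * P) (coeff_X_pow_mul_zero P hP0 r) (coeff_X_pow_mul_one P hP0 hP1 r)
  refine ⟨C, hC, fun M hM n hn hnM ↦ ?_⟩
  have hℓ1 : 1 ≤ Real.log M := one_le_log_of_three_le hM
  have hℓ0 : Real.log M ≠ 0 := by linarith
  rw [shiftedCoord_eq P r hℓ0 n, mul_div_cancel_left₀ _ (pow_ne_zero r hℓ0)]
  exact h M hM n hn hnM

/-- **Crude size of the shifted coordinate**: `|𝒮^{[r]}(M,n)| ≤ K·D(n)·log^rM/log²M` (`P₀ = P₁ = 0`, `M ≥ 3`, `1 ≤ n ≤ M`).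
[cite: KowalskiMichelVanderKam2000, Prop. 5.1 — derivation] -/
theorem abs_shiftedCoord_le (P : ℝ[X]) (hP0 : P.coeff 0 = 0) (hP1 : P.coeff 1 = 0) (r : ℕ) :
    ∃ K : ℝ, 0 ≤ K ∧ ∀ M : ℝ, 3 ≤ M → ∀ n : ℕ, n ≠ 0 → (n : ℝ) ≤ M →
      |∑ c ∈ Finset.range (P.natDegree + 1), P.coeff c *
          ((∑ k ∈ Icc 1 ⌊M / n⌋₊, (if k.Coprime n then W k else 0) * (k.divisors.card : ℝ) *
            Real.log (M / n / k) ^ (c + r)) / Real.log M ^ c)| ≤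
        K * divWeight n * Real.log M ^ r / Real.log M ^ 2 := by
  obtain ⟨C, hC, h⟩ := abs_shiftedCoord_sub_le P hP0 hP1 r
  obtain ⟨K, hK, hK'⟩ := abs_profileCoord_crude_le (derivative (derivative (X ^ r * P))) 2
    (fun M n ↦ (∑ c ∈ Finset.range (P.natDegree + 1), P.coeff c *
      ((∑ k ∈ Icc 1 ⌊M / n⌋₊, (if k.Coprime n then W k else 0) * (k.divisors.card : ℝ) *
        Real.log (M / n / k) ^ (c + r)) / Real.log M ^ c)) / Real.log M ^ r) hC h
  refine ⟨K, hK, fun M hM n hn hnM ↦ ?_⟩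
  have hℓ1 : 1 ≤ Real.log M := one_le_log_of_three_le hM
  have hℓpos : 0 < Real.log M := by linarith
  have h' := hK' M hM n hn hnM
  rw [abs_div, abs_of_pos (pow_pos hℓpos r), div_le_iff₀ (pow_pos hℓpos r)] at h'
  calc _ ≤ K * divWeight n / Real.log M ^ 2 * Real.log M ^ r := h'
    _ = K * divWeight n * Real.log M ^ r / Real.log M ^ 2 := by ring

/-! ### The bilinear main term of `(λ log M − log(M/n))^p·𝒮^{[r₁]}𝒮^{[r₂]}` -/

/-- **Bilinear main term of the shifted coordinates** (see the module docstring): for `0 ≤ λ ≤ 1`, `P₀ = P₁ = 0` and all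
`p, r₁, r₂` there is `C` with, for all `M ≥ 3`,
`|Σ_{n≤M} φ(n)W(n)²(λlog M − log(M/n))^p𝒮^{[r₁]}(M,n)𝒮^{[r₂]}(M,n) − (π²/6)²(∫₀¹(λ−u)^p(X^{r₁}P)″(X^{r₂}P)″)·log^{p+r₁+r₂}M·log M/log⁴M|
 ≤ C·log^{p+r₁+r₂}M/log⁴M`. [cite: KowalskiMichelVanderKam2000, (23)–(28) and Prop. 5.1 — derivation] -/
theorem abs_harmonicShifted_sub_le (P : ℝ[X]) (hP0 : P.coeff 0 = 0) (hP1 : P.coeff 1 = 0) (p r₁ r₂ : ℕ)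
    {lam : ℝ} (hlam0 : 0 ≤ lam) (hlam1 : lam ≤ 1) :
    ∃ C : ℝ, 0 < C ∧ ∀ M : ℝ, 3 ≤ M →
      |∑ n ∈ Icc 1 ⌊M⌋₊, (Nat.totient n : ℝ) * W n ^ 2 *
          ((lam * Real.log M - Real.log (M / n)) ^ p *
            (∑ c ∈ Finset.range (P.natDegree + 1), P.coeff c *
              ((∑ k ∈ Icc 1 ⌊M / n⌋₊, (if k.Coprime n then W k else 0) * (k.divisors.card : ℝ) *
                Real.log (M / n / k) ^ (c + r₁)) / Real.log M ^ c)) *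
            (∑ c ∈ Finset.range (P.natDegree + 1), P.coeff c *
              ((∑ k ∈ Icc 1 ⌊M / n⌋₊, (if k.Coprime n then W k else 0) * (k.divisors.card : ℝ) *
                Real.log (M / n / k) ^ (c + r₂)) / Real.log M ^ c))) -
        (π ^ 2 / 6) ^ 2 * (∫ u in (0 : ℝ)..1,
            (((Polynomial.C lam - X) ^ p * derivative (derivative (X ^ r₁ * P))) *
              derivative (derivative (X ^ r₂ * P))).eval u) *
          Real.log M ^ (p + r₁ + r₂) * Real.log M / Real.log M ^ 4| ≤
        C * Real.log M ^ (p + r₁ + r₂) / Real.log M ^ 4 := by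
  obtain ⟨C₁, hC₁, h₁⟩ := abs_shiftedCoord_sub_le P hP0 hP1 r₁
  obtain ⟨C₂, hC₂, h₂⟩ := abs_shiftedCoord_sub_le P hP0 hP1 r₂
  -- the two normalized coordinates
  set T₁ : ℝ → ℕ → ℝ := fun M n ↦ (lam - Real.log (M / n) / Real.log M) ^ p *
    ((∑ c ∈ Finset.range (P.natDegree + 1), P.coeff c *
      ((∑ k ∈ Icc 1 ⌊M / n⌋₊, (if k.Coprime n then W k else 0) * (k.divisors.card : ℝ) *
        Real.log (M / n / k) ^ (c + r₁)) / Real.log M ^ c)) / Real.log M ^ r₁) with hT₁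
  set T₂ : ℝ → ℕ → ℝ := fun M n ↦
    (∑ c ∈ Finset.range (P.natDegree + 1), P.coeff c *
      ((∑ k ∈ Icc 1 ⌊M / n⌋₊, (if k.Coprime n then W k else 0) * (k.divisors.card : ℝ) *
        Real.log (M / n / k) ^ (c + r₂)) / Real.log M ^ c)) / Real.log M ^ r₂ with hT₂
  set R₁ : ℝ[X] := (Polynomial.C lam - X) ^ p * derivative (derivative (X ^ r₁ * P)) with hR₁
  set R₂ : ℝ[X] := derivative (derivative (X ^ r₂ * P)) with hR₂
  -- `T₁` in master format (`|λ − u| ≤ 1`)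
  have hT₁' : ∀ M : ℝ, 3 ≤ M → ∀ n : ℕ, n ≠ 0 → (n : ℝ) ≤ M →
      |T₁ M n - mainConst n * R₁.eval (Real.log (M / n) / Real.log M) / Real.log M ^ 2| ≤
        C₁ * divWeight n * ((1 + kappa n) / Real.log M ^ (2 + 1) +
          1 / ((1 + Real.log (M / n)) ^ 2 * Real.log M ^ 2)) := by
    intro M hM n hn hnM
    have hℓ1 : 1 ≤ Real.log M := one_le_log_of_three_le hM
    have hℓpos : 0 < Real.log M := by linarith
    obtain ⟨hY0, hYℓ⟩ := log_div_nonneg_and_le hM hn hnM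
    set u := Real.log (M / n) / Real.log M with hu
    have hu0 : 0 ≤ u := div_nonneg hY0 hℓpos.le
    have hu1 : u ≤ 1 := (div_le_one hℓpos).2 hYℓ
    have hfac : |(lam - u) ^ p| ≤ 1 := by
      rw [abs_pow]
      exact pow_le_one₀ (abs_nonneg _) (abs_le.2 ⟨by linarith, by linarith⟩)
    have hR₁eval : R₁.eval u = (lam - u) ^ p * (derivative (derivative (X ^ r₁ * P))).eval u := by
      simp only [hR₁, Polynomial.eval_mul, Polynomial.eval_pow, Polynomial.eval_sub, Polynomial.eval_C,
        Polynomial.eval_X]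
    have hdiff : T₁ M n - mainConst n * R₁.eval u / Real.log M ^ 2 =
        (lam - u) ^ p * ((∑ c ∈ Finset.range (P.natDegree + 1), P.coeff c *
          ((∑ k ∈ Icc 1 ⌊M / n⌋₊, (if k.Coprime n then W k else 0) * (k.divisors.card : ℝ) *
            Real.log (M / n / k) ^ (c + r₁)) / Real.log M ^ c)) / Real.log M ^ r₁ -
          mainConst n * (derivative (derivative (X ^ r₁ * P))).eval u / Real.log M ^ 2) := by
      rw [hT₁, hR₁eval]; ring
    rw [hdiff, abs_mul]
    have h := h₁ M hM n hn hnM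
    calc |(lam - u) ^ p| * _ ≤ 1 * (C₁ * divWeight n * ((1 + kappa n) / Real.log M ^ (2 + 1) +
          1 / ((1 + Real.log (M / n)) ^ 2 * Real.log M ^ 2))) :=
          mul_le_mul hfac h (abs_nonneg _) zero_le_one
      _ = _ := one_mul _
  have hT₂' : ∀ M : ℝ, 3 ≤ M → ∀ n : ℕ, n ≠ 0 → (n : ℝ) ≤ M →
      |T₂ M n - mainConst n * R₂.eval (Real.log (M / n) / Real.log M) / Real.log M ^ 2| ≤
        C₂ * divWeight n * ((1 + kappa n) / Real.log M ^ (2 + 1) +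
          1 / ((1 + Real.log (M / n)) ^ 2 * Real.log M ^ 2)) := by
    intro M hM n hn hnM
    simpa only [hT₂, hR₂] using h₂ M hM n hn hnM
  obtain ⟨C, hC, h⟩ := abs_bilinearHarmonic_two_scale_sub_le R₁ R₂ 2 2 T₁ T₂ hC₁ hC₂ hT₁' hT₂'
  refine ⟨C, hC, fun M hM ↦ ?_⟩
  have hℓ1 : 1 ≤ Real.log M := one_le_log_of_three_le hM
  have hℓpos : 0 < Real.log M := by linarith
  have hℓ0 : Real.log M ≠ 0 := hℓpos.ne'
  have hM0 : 0 < M := by linarith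
  have h' := h M hM
  -- rescale by `log^{p+r₁+r₂}M`
  have hresc : ∑ n ∈ Icc 1 ⌊M⌋₊, (Nat.totient n : ℝ) * W n ^ 2 *
      ((lam * Real.log M - Real.log (M / n)) ^ p *
        (∑ c ∈ Finset.range (P.natDegree + 1), P.coeff c *
          ((∑ k ∈ Icc 1 ⌊M / n⌋₊, (if k.Coprime n then W k else 0) * (k.divisors.card : ℝ) *
            Real.log (M / n / k) ^ (c + r₁)) / Real.log M ^ c)) *
        (∑ c ∈ Finset.range (P.natDegree + 1), P.coeff c *
          ((∑ k ∈ Icc 1 ⌊M / n⌋₊, (if k.Coprime n then W k else 0) * (k.divisors.card : ℝ) *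
            Real.log (M / n / k) ^ (c + r₂)) / Real.log M ^ c))) =
      Real.log M ^ (p + r₁ + r₂) * ∑ n ∈ Icc 1 ⌊M⌋₊, (Nat.totient n : ℝ) * W n ^ 2 * (T₁ M n * T₂ M n) := by
    rw [Finset.mul_sum]
    refine Finset.sum_congr rfl fun n _ ↦ ?_
    have hfac : (lam * Real.log M - Real.log (M / n)) ^ p =
        Real.log M ^ p * (lam - Real.log (M / n) / Real.log M) ^ p := by
      rw [← mul_pow]; congr 1; field_simp
    simp only [hT₁, hT₂]
    rw [hfac, pow_add, pow_add]
    field_simp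
  rw [hresc]
  have e : Real.log M ^ (p + r₁ + r₂) * ∑ n ∈ Icc 1 ⌊M⌋₊, (Nat.totient n : ℝ) * W n ^ 2 * (T₁ M n * T₂ M n) -
      (π ^ 2 / 6) ^ 2 * (∫ u in (0 : ℝ)..1, (R₁ * R₂).eval u) * Real.log M ^ (p + r₁ + r₂) * Real.log M /
        Real.log M ^ 4 =
      Real.log M ^ (p + r₁ + r₂) * (∑ n ∈ Icc 1 ⌊M⌋₊, (Nat.totient n : ℝ) * W n ^ 2 * (T₁ M n * T₂ M n) -
        (π ^ 2 / 6) ^ 2 * (∫ u in (0 : ℝ)..1, (R₁ * R₂).eval u) * Real.log M / Real.log M ^ (2 + 2)) := by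
    ring
  rw [e, abs_mul, abs_of_pos (pow_pos hℓpos _)]
  calc Real.log M ^ (p + r₁ + r₂) * _ ≤ Real.log M ^ (p + r₁ + r₂) * (C / Real.log M ^ (2 + 2)) :=
        mul_le_mul_of_nonneg_left h' (pow_nonneg hℓpos.le _)
    _ = C * Real.log M ^ (p + r₁ + r₂) / Real.log M ^ 4 := by ring

end Summit.Parity.GeneralizedHardyLittlewood.Theorems.MomentsBeyondDiagonal.DiagKernel

end
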